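import Summits.CriticalPhenomena.PercolationContinuityZ3.Theorems.PercNearOneGluingNoHeavyLowerTailSahiThreeCopyMixedLiterals

/-!
# `NoHeavyLowerTail` (crux stmt-CriticalPhenomena-4575), Sahi programme: **THE READ-ONCE CLOSURE THEOREM FOR 3C-SAHI** — every triple of events /
# `[0,1]`-valued monotone functions built from the settled bases (constants, one principal-cylinder slot, a nested pair) by disjoint-block `∧`,
# disjoint-block `∨`, independent literal adjunction (`skip / ∧x / ∨x` per slot) and slot permutations satisfies the three-copy Sahi inequality
# `c_b ≥ 0` at EVERY profile, hence `E₃ ≥ 0` under every product measure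

Support file (Sahi cell, seat `prim-sahi-p1`, generation 54; `--supports stmt-CriticalPhenomena-4575`); capstone over `…Blocks` (`tc_tens_nonneg_all`),
`…BlockOr` (`tc_orTens_nonneg_all`), `…MixedLiterals` (`tc_litAdj_cons_nonneg`), `…Cylinder` (`tc_setInd_principal_nonneg`), `…Nested`
(`tc_setInd_nonneg_of_subset₂₃`).  One inductive type of SKELETONS (`RO n`, with its interpretation `RO.f₁/f₂/f₃ : Pt n → ℝ`) and the master theorem
`RO.tc_nonneg`; law level `RO.sahiE_three_coin_nonneg`.  No `sorry`, standard axioms.  Coverage (memo FROM-prim-sahi-p1-gen54-READONCE-CLOSURE, code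
coverage.py): all 216 ordered triples of up-sets of `{0,1}²`, and 7988 of the 8000 on `{0,1}³` (the 12 exceptions are the two S₃-orbits of the 'median
gadget' `(x₁∨x₂x₃, x₃∨x₁x₂, x₂∨x₁x₃)` and its dual, settled separately for ARBITRARY up-sets `U, V` in place of `x₂, x₃` in `…Gadget`:
`tc_gadget_cons_nonneg`, `tc_dualGadget_cons_nonneg` — so every ordered triple of up-sets of `{0,1}³` is covered by a theorem of this chain).  The census
conjecture 3C-SAHI itself (all up-set triples, CENSUS §175 W197) remains OPEN; nothing conjectural is used here. [this work]
-/

namespace Summit.CriticalPhenomena.PercolationContinuityZ3.Theorems.SahiThreeCopy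

open Finset Function Literature.Combinatorics.Sahi2008
open scoped BigOperators

noncomputable section

/-! ### §1 Range lemmas for the block operations -/

/-- Block products of `[0,1]`-valued functions are `≤ 1`. [this work] -/
theorem tens_le_one {d : ℕ} : ∀ (m : ℕ) {g : Pt m → ℝ} {f : Pt d → ℝ}, (∀ y, 0 ≤ g y) → (∀ y, g y ≤ 1) → (∀ x, 0 ≤ f x) → (∀ x, f x ≤ 1) →
    ∀ x, tens m g f x ≤ 1
  | 0, _, _, hg0, hg1, hf0, hf1, x => by
    simp only [tens, Pi.smul_apply, smul_eq_mul]; exact mul_le_one₀ (hg1 _) (hf0 x) (hf1 x)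
  | m + 1, _, _, hg0, hg1, hf0, hf1, x => by
    simp only [tens]; exact tens_le_one m (sec_nonneg hg0 _) (fun y => hg1 _) hf0 hf1 _

/-- `orTens` takes values in `[0,1]` and is monotone for `[0,1]`-valued monotone arguments. [this work] -/
theorem orTens_props {d : ℕ} (m : ℕ) {g : Pt m → ℝ} {f : Pt d → ℝ} (hg0 : ∀ y, 0 ≤ g y) (hg1 : ∀ y, g y ≤ 1) (hgm : Monotone g)
    (hf0 : ∀ x, 0 ≤ f x) (hf1 : ∀ x, f x ≤ 1) (hfm : Monotone f) :
    (∀ x, 0 ≤ orTens m g f x) ∧ (∀ x, orTens m g f x ≤ 1) ∧ Monotone (orTens m g f) := by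
  have cg0 : ∀ y, 0 ≤ (1 - g) y := fun y => sub_nonneg.2 (hg1 y)
  have cg1 : ∀ y, (1 - g) y ≤ 1 := fun y => by simp [hg0 y]
  have cf0 : ∀ x, 0 ≤ (1 - f) x := fun x => sub_nonneg.2 (hf1 x)
  have cf1 : ∀ x, (1 - f) x ≤ 1 := fun x => by simp [hf0 x]
  refine ⟨fun x => ?_, fun x => ?_, fun x y hxy => ?_⟩
  · simp only [orTens, Pi.sub_apply, Pi.one_apply]; linarith [tens_le_one m cg0 cg1 cf0 cf1 x]
  · simp only [orTens, Pi.sub_apply, Pi.one_apply]; linarith [tens_nonneg m cg0 cf0 x]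
  · -- tens of antitone functions is antitone: use monotonicity of tens in each factor along the reversed order
    simp only [orTens, Pi.sub_apply, Pi.one_apply]
    have key : ∀ (m : ℕ) {g : Pt m → ℝ} {f : Pt d → ℝ}, (∀ y, 0 ≤ g y) → Antitone g → (∀ x, 0 ≤ f x) → Antitone f →
        ∀ {x y : Pt (d + m)}, x ≤ y → tens m g f y ≤ tens m g f x := by
      intro m
      induction m with
      | zero =>
        intro g f hg hga hf hfa x y hxy
        simp only [tens, Pi.smul_apply, smul_eq_mul]
        exact mul_le_mul_of_nonneg_left (hfa hxy) (hg _)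
      | succ m ih =>
        intro g f hg hga hf hfa x y hxy
        simp only [tens]
        have ht : Fin.tail x ≤ Fin.tail y := fun i => hxy i.succ
        have hsec : ∀ ε, Antitone (sec g ε) := fun ε a b hab => hga (Fin.cons_le_cons.2 ⟨le_rfl, hab⟩)
        calc tens m (sec g (y 0)) f (Fin.tail y) ≤ tens m (sec g (y 0)) f (Fin.tail x) :=
              ih (sec_nonneg hg _) (hsec _) hf hfa ht
          _ ≤ tens m (sec g (x 0)) f (Fin.tail x) :=
              tens_monotone.tens_mono_front m (fun z => hga (Fin.cons_le_cons.2 ⟨hxy 0, le_rfl⟩)) hf _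
    have anti_g : Antitone (1 - g) := fun a b hab => by simp only [Pi.sub_apply, Pi.one_apply]; linarith [hgm hab]
    have anti_f : Antitone (1 - f) := fun a b hab => by simp only [Pi.sub_apply, Pi.one_apply]; linarith [hfm hab]
    linarith [key m cg0 anti_g cf0 anti_f hxy]

/-! ### §2 Read-once skeletons and their interpretation -/

/-- READ-ONCE TRIPLE SKELETONS on `{0,1}^n`: constants; a principal-cylinder slot with two arbitrary up-sets; a nested pair with an arbitrary third up-set;
independent literal adjunction; disjoint-block conjunction / disjunction; slot permutations. [this work] -/
inductive RO : ℕ → Type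
  | const (n : ℕ) (c₁ c₂ c₃ : ℝ) (h₁ : 0 ≤ c₁ ∧ c₁ ≤ 1) (h₂ : 0 ≤ c₂ ∧ c₂ ≤ 1) (h₃ : 0 ≤ c₃ ∧ c₃ ≤ 1) : RO n
  | cylSlot {n : ℕ} (mₚ : Pt n) (B C : Finset (Pt n)) (hB : IsUpperSet (B : Set (Pt n))) (hC : IsUpperSet (C : Set (Pt n))) : RO n
  | nested {n : ℕ} (A B C : Finset (Pt n)) (hA : IsUpperSet (A : Set (Pt n))) (hB : IsUpperSet (B : Set (Pt n)))
      (hC : IsUpperSet (C : Set (Pt n))) (hBC : B ⊆ C) : RO n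
  | lit {n : ℕ} (κ₁ κ₂ κ₃ : Kind) (t : RO n) : RO (n + 1)
  | band {n m : ℕ} (s : RO m) (t : RO n) : RO (n + m)
  | bor {n m : ℕ} (s : RO m) (t : RO n) : RO (n + m)
  | swap₁₂ {n : ℕ} (t : RO n) : RO n
  | swap₂₃ {n : ℕ} (t : RO n) : RO n

/-- The triple of functions of a skeleton. [this work] -/
def RO.fns : {n : ℕ} → RO n → (Pt n → ℝ) × (Pt n → ℝ) × (Pt n → ℝ)
  | _, .const _ c₁ c₂ c₃ _ _ _ => (fun _ => c₁, fun _ => c₂, fun _ => c₃)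
  | _, .cylSlot mₚ B C _ _ => (setInd (univ.filter fun x => ∀ i, mₚ i = true → x i = true), setInd B, setInd C)
  | _, .nested A B C _ _ _ _ => (setInd A, setInd B, setInd C)
  | _, .lit κ₁ κ₂ κ₃ t => (litAdj κ₁ t.fns.1, litAdj κ₂ t.fns.2.1, litAdj κ₃ t.fns.2.2)
  | _, .band (m := m) s t => (tens m s.fns.1 t.fns.1, tens m s.fns.2.1 t.fns.2.1, tens m s.fns.2.2 t.fns.2.2)
  | _, .bor (m := m) s t => (orTens m s.fns.1 t.fns.1, orTens m s.fns.2.1 t.fns.2.1, orTens m s.fns.2.2 t.fns.2.2)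
  | _, .swap₁₂ t => (t.fns.2.1, t.fns.1, t.fns.2.2)
  | _, .swap₂₃ t => (t.fns.1, t.fns.2.2, t.fns.2.1)

/-- The invariant carried through the induction: all three functions are `[0,1]`-valued and monotone, and `c_b ≥ 0` at every profile. [this work] -/
def ROGood {n : ℕ} (F : (Pt n → ℝ) × (Pt n → ℝ) × (Pt n → ℝ)) : Prop :=
  ((∀ x, 0 ≤ F.1 x) ∧ (∀ x, F.1 x ≤ 1) ∧ Monotone F.1) ∧ ((∀ x, 0 ≤ F.2.1 x) ∧ (∀ x, F.2.1 x ≤ 1) ∧ Monotone F.2.1) ∧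
    ((∀ x, 0 ≤ F.2.2 x) ∧ (∀ x, F.2.2 x ≤ 1) ∧ Monotone F.2.2) ∧ ∀ b : Fin n → ℕ, 0 ≤ tc b F.1 F.2.1 F.2.2

/-- Indicators of up-sets are good data. [this work] -/
theorem setInd_good {n : ℕ} {A : Finset (Pt n)} (hA : IsUpperSet (A : Set (Pt n))) :
    (∀ x, 0 ≤ setInd A x) ∧ (∀ x, setInd A x ≤ 1) ∧ Monotone (setInd A) :=
  ⟨setInd_nonneg A, fun x => by unfold setInd; split_ifs <;> norm_num, monotone_setInd hA⟩

/-- ★★★ **THE READ-ONCE CLOSURE THEOREM**: every skeleton's triple is good; in particular `0 ≤ c_b` at every profile. [this work] -/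
theorem RO.good : ∀ {n : ℕ} (t : RO n), ROGood t.fns
  | _, .const n c₁ c₂ c₃ h₁ h₂ h₃ =>
    ⟨⟨fun _ => h₁.1, fun _ => h₁.2, fun _ _ _ => le_rfl⟩, ⟨fun _ => h₂.1, fun _ => h₂.2, fun _ _ _ => le_rfl⟩,
      ⟨fun _ => h₃.1, fun _ => h₃.2, fun _ _ _ => le_rfl⟩, fun b => by simp only [RO.fns]; rw [tc_const]⟩
  | _, .cylSlot (n := n) mₚ B C hB hC => by
    have hA : IsUpperSet ((univ.filter fun x : Pt n => ∀ i, mₚ i = true → x i = true : Finset (Pt n)) : Set (Pt n)) := by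
      intro x y hxy hx
      simp only [coe_filter, mem_univ, true_and, Set.mem_setOf_eq] at hx ⊢
      exact fun i hi => Bool.eq_true_of_true_le ((hx i hi) ▸ hxy i)
    exact ⟨setInd_good hA, setInd_good hB, setInd_good hC, fun b => tc_setInd_principal_nonneg b mₚ hB hC⟩
  | _, .nested A B C hA hB hC hBC => ⟨setInd_good hA, setInd_good hB, setInd_good hC, fun b => tc_setInd_nonneg_of_subset₂₃ b hA hB hC hBC⟩
  | _, .lit κ₁ κ₂ κ₃ t => by
    obtain ⟨⟨f0, f1, fm⟩, ⟨g0, g1, gm⟩, ⟨h0, h1, hm⟩, htc⟩ := RO.good t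
    refine ⟨litAdj_props κ₁ f0 f1 fm, litAdj_props κ₂ g0 g1 gm, litAdj_props κ₃ h0 h1 hm, fun b => ?_⟩
    have hb : b = Fin.cons (b 0) (Fin.tail b) := (Fin.cons_self_tail b).symm
    simp only [RO.fns]; rw [hb]
    exact tc_litAdj_cons_nonneg (b 0) (Fin.tail b) κ₁ κ₂ κ₃ f0 f1 fm g0 g1 gm h0 h1 hm (htc _)
  | _, .band (m := m) s t => by
    obtain ⟨⟨sf0, sf1, sfm⟩, ⟨sg0, sg1, sgm⟩, ⟨sh0, sh1, shm⟩, stc⟩ := RO.good s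
    obtain ⟨⟨f0, f1, fm⟩, ⟨g0, g1, gm⟩, ⟨h0, h1, hm⟩, htc⟩ := RO.good t
    refine ⟨⟨tens_nonneg m sf0 f0, tens_le_one m sf0 sf1 f0 f1, tens_monotone m sf0 sfm f0 fm⟩,
      ⟨tens_nonneg m sg0 g0, tens_le_one m sg0 sg1 g0 g1, tens_monotone m sg0 sgm g0 gm⟩,
      ⟨tens_nonneg m sh0 h0, tens_le_one m sh0 sh1 h0 h1, tens_monotone m sh0 shm h0 hm⟩, fun b => ?_⟩
    simp only [RO.fns]
    exact tc_tens_nonneg_all m sf0 sfm sg0 sgm sh0 shm f0 fm g0 gm h0 hm stc htc b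
  | _, .bor (m := m) s t => by
    obtain ⟨⟨sf0, sf1, sfm⟩, ⟨sg0, sg1, sgm⟩, ⟨sh0, sh1, shm⟩, stc⟩ := RO.good s
    obtain ⟨⟨f0, f1, fm⟩, ⟨g0, g1, gm⟩, ⟨h0, h1, hm⟩, htc⟩ := RO.good t
    refine ⟨orTens_props m sf0 sf1 sfm f0 f1 fm, orTens_props m sg0 sg1 sgm g0 g1 gm, orTens_props m sh0 sh1 shm h0 h1 hm, fun b => ?_⟩
    simp only [RO.fns]
    exact tc_orTens_nonneg_all m sf0 sf1 sfm sg0 sg1 sgm sh0 sh1 shm f0 f1 fm g0 g1 gm h0 h1 hm stc htc b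
  | _, .swap₁₂ t => by
    obtain ⟨hf, hg, hh, htc⟩ := RO.good t
    exact ⟨hg, hf, hh, fun b => by simp only [RO.fns]; rw [tc_comm12]; exact htc b⟩
  | _, .swap₂₃ t => by
    obtain ⟨hf, hg, hh, htc⟩ := RO.good t
    exact ⟨hf, hh, hg, fun b => by simp only [RO.fns]; rw [tc_comm23]; exact htc b⟩

/-- ★★ **3C-SAHI on the read-once class**: `0 ≤ c_b(F₁,F₂,F₃)` for every skeleton and every profile. [this work] -/
theorem RO.tc_nonneg {n : ℕ} (t : RO n) (b : Fin n → ℕ) : 0 ≤ tc b t.fns.1 t.fns.2.1 t.fns.2.2 := (RO.good t).2.2.2 b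

/-- ★ **Law level**: `0 ≤ E₃^{coin q}(F₁,F₂,F₃)` for every skeleton and every product (coin) weight `q ∈ [0,1]^n` — Sahi's `C₃` instance for the whole
read-once class. [this work] -/
theorem RO.sahiE_three_coin_nonneg {n : ℕ} (t : RO n) {q : Fin n → ℝ} (hq : ∀ i, 0 ≤ q i ∧ q i ≤ 1) :
    0 ≤ sahiE (coinWeight q) 3 ![t.fns.1, t.fns.2.1, t.fns.2.2] :=
  sahiE_three_coin_nonneg_of_tc hq fun b => RO.tc_nonneg t b

end

end Summit.CriticalPhenomena.PercolationContinuityZ3.Theorems.SahiThreeCopy
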